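import Literature.NumberTheory.EllipticCurves.VeluNormProofs
import Literature.NumberTheory.EllipticCurves.ReductionHomomorphism
import Literature.NumberTheory.EllipticCurves.TorsionCardinality
import Mathlib.GroupTheory.Perm.Cycle.Type
import Mathlib.Data.Nat.Factors
import HarnessLib

/-!
# The canonical subgroup from a factor of the `p`-division polynomial
# (Blakestad–Grant 2023, Prop. 7, eq. (4): `φ_ψ(x) = pD(x)`; proofs only)

Trunk T-NT-EC (Literature/NumberTheory/EllipticCurves). Input for the tree's Vélu machinery
(`VeluOddKernelProofs`, `VeluNormProofs`, `VeluKernelReductionProofs`: a finite subgroup `G`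
without `2`-torsion, `IsOddSubgroupFinset G`, with `x`-values `veluXVals G` and kernel polynomial
`veluD G = Π(X - c)`). Setting: a field `L` (algebraically closed) valued by `v` with valuation
ring `R` (`v.Integers R`), an integral Weierstrass equation `W/R`, elliptic over `L`, an odd prime
`p = 2n + 1`, and a factorisation of the `p`-division polynomial over `L`,

  `ψ_p = φ·ξ`, `deg φ = n`, the roots of `ξ` integral, the roots of `φ` NOT integral

(as produced by Hensel's lemma from `ψ_p ≡ (unit)·x^{(p²-p)/2}+⋯ (mod p)` for an ordinary curve:
Blakestad–Grant Prop. 7, "`φ_ψ` … the factor of `ψ_p` corresponding to the canonical subgroup").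
Then (`exists_canonicalKernel`):

  **`G := E[p](L) ∩ E₁(L)` is a finite subgroup without `2`-torsion of order exactly `p`, its
  `x`-values are the roots of `φ`, and `φ = lc(φ)·veluD G`** (so `veluD G = φ_ψ/p`).

Proof: `G` is a subgroup (`E₁` is one: `ReducesToZero.add`; `p`-torsion is one) without
`2`-torsion (`gcd(2, p) = 1`); an affine `p`-torsion point has `ψ_p(x) = 0`
(`zsmul_some_eq_zero_iff_eval_ΨSq`), and a point of `E₁` has `x ∉ R`, so its `x` is a root of `φ`;
conversely every root of `φ` carries two points of `G`. Hence `#G = 2r + 1 ≤ p`, `r` the number of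
distinct roots of `φ`, `r ≥ 1`; `#G` is a power of `p` (Cauchy), so `#G = p`, `r = n`, and `φ`
has `n` simple roots.

## Sources

* C. Blakestad, D. Grant, J. Number Theory 249 (2023) (arXiv:1903.02480), Prop. 7 and its proof
  (the canonical subgroup `C`, `φ_ψ(x) = p·Π(x - x(Q))`, eq. (4)). [BlakestadGrant2023]
* J. H. Silverman, *AEC* 2nd ed. (2009), VII.2.1–2.2 (`E₁`), V.3.1(a), Exercise 3.7(f).
  [SilvermanAEC2009]

Pure proof file: no definitions, no named facts.
-/

noncomputable section

open scoped Classical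
open Polynomial

namespace WeierstrassCurve

variable {L : Type*} [Field L] [IsAlgClosed L] {Γ₀ : Type*} [LinearOrderedCommGroupWithZero Γ₀]
  {v : Valuation L Γ₀} {R : Type*} [CommRing R] [Algebra R L]
  (W : WeierstrassCurve R) [(W.baseChange L).IsElliptic]

omit [(W.baseChange L).IsElliptic] in
/-- Every `x ∈ L` (algebraically closed) is the `x`-coordinate of an affine point. [folklore] -/
theorem exists_equation_baseChange_of_isAlgClosed (x : L) : ∃ y : L, (W.baseChange L).toAffine.Equation x y := by
  set V := (W.baseChange L).toAffine with hV
  -- the Weierstrass polynomial in `Y` at `X = x` is monic of degree `2`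
  set q : L[X] := Polynomial.X ^ 2 + Polynomial.C (V.a₁ * x + V.a₃) * Polynomial.X -
    Polynomial.C (x ^ 3 + V.a₂ * x ^ 2 + V.a₄ * x + V.a₆) with hq
  have hdeg : q.degree = 2 := by
    rw [hq]; compute_degree!
  obtain ⟨y, hy⟩ := IsAlgClosed.exists_root q (by rw [hdeg]; exact two_ne_zero)
  refine ⟨y, ?_⟩
  rw [WeierstrassCurve.Affine.equation_iff]
  rw [Polynomial.IsRoot, hq] at hy
  simp only [eval_sub, eval_add, eval_pow, eval_X, eval_mul, eval_C] at hy
  linear_combination hy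

/-- **The canonical subgroup from the canonical factor of `ψ_p`.** See the module docstring.
[Blakestad–Grant 2023, Prop. 7 (eq. (4)); Silverman AEC VII.2.1, V.3.1(a), Ex. 3.7(f)]
[cite: BlakestadGrant2023, Prop. 7] -/
theorem exists_canonicalKernel (hv : v.Integers R) {p n : ℕ} [Fact p.Prime] (hp : 2 * n + 1 = p) (hn : 1 ≤ n)
    {φ ξ : L[X]} (hfact : (W.baseChange L).preΨ' p = φ * ξ) (hφn : φ.natDegree = n)
    (hξ : ∀ c, ξ.IsRoot c → c ∈ Set.range (algebraMap R L))
    (hφ : ∀ c, φ.IsRoot c → c ∉ Set.range (algebraMap R L)) :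
    ∃ G : Finset (W.baseChange L).toAffine.Point,
      Affine.Point.IsOddSubgroupFinset G ∧ 2 * (Affine.Point.veluXVals G).card + 1 = p ∧
      Affine.Point.veluXVals G = φ.roots.toFinset ∧
      φ = Polynomial.C φ.leadingCoeff * Affine.Point.veluD G ∧
      (∀ P ∈ G, ReducesToZero W P) ∧ (∀ P ∈ G, (p : ℤ) • P = 0) := by
  have hpp : p.Prime := Fact.out
  have hp2 : p ≠ 2 := by omega
  have hodd : ¬ Even p := fun he => by rcases he with ⟨k, hk⟩; omega
  set V := W.baseChange L with hV
  have hφ0 : φ ≠ 0 := by rintro rfl; rw [natDegree_zero] at hφn; omega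
  -- `ΨSq_p(x) = 0 ↔ φ(x)ξ(x) = 0`
  have hΨ : ∀ x : L, (V.ΨSq p).eval x = 0 ↔ φ.eval x * ξ.eval x = 0 := fun x => by
    rw [WeierstrassCurve.ΨSq_ofNat, if_neg hodd, mul_one, eval_pow, pow_eq_zero_iff two_ne_zero, hfact, eval_mul]
  -- the set `G = E[p] ∩ E₁`
  set S : Set V.toAffine.Point := {P | (p : ℤ) • P = 0 ∧ ReducesToZero W P} with hS
  -- finiteness: affine points of `S` have `x` a root of `φ`
  have hxroot : ∀ {x y : L} (h : V.toAffine.Nonsingular x y),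
      (Affine.Point.some x y h : V.toAffine.Point) ∈ S → φ.IsRoot x := by
    intro x y h hP
    obtain ⟨hpP, hred⟩ := hP
    rw [V.zsmul_some_eq_zero_iff_eval_ΨSq h, hΨ] at hpP
    rw [reducesToZero_some_iff] at hred
    rcases mul_eq_zero.mp hpP with h1 | h2
    · exact h1
    · exact absurd (hξ x h2) hred
  have hfin : S.Finite := by
    -- `S ∖ {O}` injects into `roots φ × roots of quadratics`; we bound via `x ↦` finitely many `y`
    have hsub : S ⊆ insert 0 (⋃ c ∈ (φ.roots.toFinset : Set L),
        {P | ∃ (y : L) (h : V.toAffine.Nonsingular c y), P = Affine.Point.some c y h}) := by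
      intro P hP
      rcases P with _ | ⟨x, y, h⟩
      · exact Set.mem_insert _ _
      · refine Set.mem_insert_of_mem _ (Set.mem_biUnion (x := x) ?_ ⟨y, h, rfl⟩)
        rw [Finset.mem_coe, Multiset.mem_toFinset, mem_roots hφ0]; exact hxroot h hP
    refine Set.Finite.subset (Set.Finite.insert _ (Set.Finite.biUnion (Finset.finite_toSet _) fun c _ => ?_)) hsub
    -- for fixed `c`, at most the `y` with `equation c y`: roots of a nonzero quadratic
    set q : L[X] := Polynomial.X ^ 2 + Polynomial.C (V.toAffine.a₁ * c + V.toAffine.a₃) * Polynomial.X -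
      Polynomial.C (c ^ 3 + V.toAffine.a₂ * c ^ 2 + V.toAffine.a₄ * c + V.toAffine.a₆) with hq
    have hq0 : q ≠ 0 := by
      have : q.degree = 2 := by rw [hq]; compute_degree!
      intro h0; rw [h0, degree_zero] at this; exact absurd this (by decide)
    have hyroot : ∀ y, V.toAffine.Equation c y → y ∈ q.roots.toFinset := fun y hy => by
      rw [Multiset.mem_toFinset, mem_roots hq0, IsRoot, hq]
      rw [WeierstrassCurve.Affine.equation_iff] at hy
      simp only [eval_sub, eval_add, eval_pow, eval_X, eval_mul, eval_C]
      linear_combination hy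
    refine Set.Finite.subset ((q.roots.toFinset.finite_toSet).image fun y : L =>
      if h : V.toAffine.Nonsingular c y then (Affine.Point.some c y h : V.toAffine.Point) else 0) ?_
    rintro P ⟨y, h, rfl⟩
    exact ⟨y, hyroot y h.1, by simp [h]⟩
  set G : Finset V.toAffine.Point := hfin.toFinset with hGdef
  have hmemG : ∀ P, P ∈ G ↔ (p : ℤ) • P = 0 ∧ ReducesToZero W P := fun P => by
    rw [hGdef, Set.Finite.mem_toFinset]; rfl
  -- `G` is a finite subgroup without `2`-torsion
  have hG : Affine.Point.IsOddSubgroupFinset G := by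
    refine ⟨?_, ?_, ?_, ?_⟩
    · rw [hmemG]; exact ⟨smul_zero _, reducesToZero_zero⟩
    · intro P hP Q hQ
      rw [hmemG] at hP hQ ⊢
      exact ⟨by rw [smul_add, hP.1, hQ.1, add_zero], hP.2.add hv hQ.2⟩
    · intro P hP
      rw [hmemG] at hP ⊢
      exact ⟨by rw [smul_neg, hP.1, neg_zero], hP.2.neg⟩
    · intro P hP hneg
      rw [hmemG] at hP
      have h2 : (2 : ℤ) • P = 0 := by rw [two_smul]; nth_rw 1 [← hneg]; exact neg_add_cancel P
      calc P = (1 : ℤ) • P := (one_smul ℤ P).symm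
        _ = ((p : ℤ) - n * 2) • P := by congr 1; rw [← hp]; push_cast; ring
        _ = 0 := by rw [sub_smul, mul_smul, h2, smul_zero, hP.1, sub_zero]
  -- the `x`-values of `G` are the roots of `φ`
  have hxvals : Affine.Point.veluXVals G = φ.roots.toFinset := by
    ext c
    rw [Multiset.mem_toFinset, mem_roots hφ0, Affine.Point.veluXVals, Finset.mem_image]
    constructor
    · rintro ⟨P, hP, rfl⟩
      obtain ⟨hP0, hPG⟩ := Finset.mem_erase.mp hP
      rw [hmemG] at hPG
      rcases P with _ | ⟨x, y, h⟩
      · exact absurd rfl hP0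
      · exact hxroot h hPG
    · intro hc
      obtain ⟨y, hy⟩ := W.exists_equation_baseChange_of_isAlgClosed c
      have h := Affine.equation_iff_nonsingular.mp hy
      refine ⟨Affine.Point.some c y h, Finset.mem_erase.mpr ⟨by simp, ?_⟩, rfl⟩
      rw [hmemG]
      refine ⟨?_, ?_⟩
      · rw [V.zsmul_some_eq_zero_iff_eval_ΨSq h, hΨ, hc.eq_zero, zero_mul]
      · rw [reducesToZero_some_iff]; exact hφ c hc
  -- counting: `#G = 2r + 1`, `1 ≤ r ≤ n`, and `#G` is a power of `p`
  set r := (Affine.Point.veluXVals G).card with hr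
  have hrle : r ≤ n := by
    rw [hr, hxvals, ← hφn]
    exact (Multiset.toFinset_card_le _).trans (Polynomial.card_roots' φ)
  have hr1 : 1 ≤ r := by
    obtain ⟨c, hc⟩ := IsAlgClosed.exists_root φ (by
      rw [Polynomial.degree_eq_natDegree hφ0, hφn]; exact_mod_cast (show n ≠ 0 by omega))
    rw [hr, hxvals, Nat.one_le_iff_ne_zero, Ne, Finset.card_eq_zero, ← Ne, ← Finset.nonempty_iff_ne_empty]
    exact ⟨c, by rw [Multiset.mem_toFinset, mem_roots hφ0]; exact hc⟩
  have hcardG : G.card = 2 * r + 1 := by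
    rw [← Finset.card_erase_add_one hG.zero_mem, Affine.Point.card_erase_zero_eq hG]
  have hcardp : G.card = p := by
    -- the subgroup with underlying set `G`
    let H : AddSubgroup V.toAffine.Point :=
      { carrier := ↑G
        add_mem' := fun ha hb => hG.add_mem _ ha _ hb
        zero_mem' := hG.zero_mem
        neg_mem' := fun ha => hG.neg_mem _ ha }
    letI hF : Fintype H := Fintype.ofFinset G fun _ => Iff.rfl
    have hHcard : Fintype.card H = G.card := @Fintype.card_ofFinset _ (H : Set V.toAffine.Point) G (fun _ => Iff.rfl)
    have hprimes : ∀ {q : ℕ}, q.Prime → q ∣ G.card → q = p := by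
      intro q hq hqd
      haveI : Fact q.Prime := ⟨hq⟩
      rw [← hHcard] at hqd
      obtain ⟨x, hx⟩ := exists_prime_addOrderOf_dvd_card q hqd
      have hxG : (x : V.toAffine.Point) ∈ G := x.2
      rw [hmemG] at hxG
      have hdvd : addOrderOf (x : V.toAffine.Point) ∣ p := by
        rw [addOrderOf_dvd_iff_nsmul_eq_zero, ← natCast_zsmul]; exact hxG.1
      rw [AddSubgroup.addOrderOf_coe, hx] at hdvd
      exact (Nat.prime_dvd_prime_iff_eq hq hpp).mp hdvd
    have hG0 : G.card ≠ 0 := by omega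
    have hpow := Nat.eq_prime_pow_of_unique_prime_dvd hG0 hprimes
    set k := G.card.primeFactorsList.length
    rcases Nat.eq_zero_or_pos k with hk | hk
    · rw [hk, pow_zero] at hpow; omega
    · have hle : G.card ≤ p := by omega
      have hge : p ≤ G.card := by
        rw [hpow]; exact Nat.le_self_pow (by omega) p
      omega
  have hrn : r = n := by omega
  refine ⟨G, hG, by omega, hxvals, ?_, fun P hP => ((hmemG P).mp hP).2, fun P hP => ((hmemG P).mp hP).1⟩
  -- `φ` has `n` simple roots, so `φ = lc(φ)·Π(X - c)`
  have hcardroots : Multiset.card φ.roots = φ.natDegree := by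
    refine le_antisymm (Polynomial.card_roots' φ) ?_
    rw [hφn, ← hrn, hr, hxvals]; exact Multiset.toFinset_card_le _
  have hnodup : φ.roots.Nodup := by
    rw [← Multiset.toFinset_card_eq_card_iff_nodup, hcardroots, hφn, ← hrn, hr, hxvals]
  conv_lhs => rw [← Polynomial.C_leadingCoeff_mul_prod_multiset_X_sub_C hcardroots]
  rw [Affine.Point.veluD, hxvals, Finset.prod_eq_multiset_prod, Multiset.toFinset_val, hnodup.dedup]

end WeierstrassCurve
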